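import Mathlib
import Literature.MathematicalPhysics.QuantumFieldTheory.WilsonSiteRPForm
import HarnessLib

/-!
# Cauchy–Schwarz for Gram sums of a reflection-positive form (crux stmt-QuantumFields-9735, line `Sketch`)

Helper toward the lead's stub `stub_signedFloor`: every step of the reflection-positivity PEELING
is the inequality `Z(E) · Z(E') ≥ Z(E'')²` for three bond-diluted signed partition functions,
obtained from the positive-semidefiniteness of the `2 × 2` matrix
`M_{AB} = Σ_k B(φ^A_k, φ^B_k)` of GRAM SUMS of a reflection-positive Hermitian form `B` (the pure
gauge Osterwalder–Seiler form, site or link reflection) over finitely many admissible features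
`φ^A_k` (the Gram expansion of the diluted Wilson determinant). This file proves that abstract step,
for an arbitrary form `B` on functions `X → ℂ` that is non-negative and Hermitian on an admissible
class closed under `F + t • G` and expands quadratically:

* `re_sum_form_nonneg` — `0 ≤ Re Σ_k B(φ_k, φ_k)`;
* `norm_sum_form_sq_le` — `‖Σ_k B(φ_k, ψ_k)‖² ≤ Re Σ_k B(φ_k, φ_k) · Re Σ_k B(ψ_k, ψ_k)`.

The scalar input is the tree's `WilsonSiteRP.normSq_le_mul_of_forall_quadratic`. All proved.
-/

noncomputable section

open Finset Complex
open scoped ComplexConjugate BigOperators ComplexOrder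

namespace Summit.QuantumFields.QCD.Theorems.UnquenchedChessboardBoundLine

variable {X K : Type*} [Fintype K]

/-- **Gram sums of a positive form are non-negative**: `0 ≤ Re Σ_k B(φ_k, φ_k)`. -/
theorem re_sum_form_nonneg (B : (X → ℂ) → (X → ℂ) → ℂ) (Adm : (X → ℂ) → Prop)
    (hpos : ∀ F, Adm F → 0 ≤ B F F) (φ : K → X → ℂ) (hφ : ∀ k, Adm (φ k)) :
    0 ≤ (∑ k, B (φ k) (φ k)).re := by
  rw [Complex.re_sum]
  exact Finset.sum_nonneg fun k _ => (Complex.nonneg_iff.1 (hpos _ (hφ k))).1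

/-- **Cauchy–Schwarz for Gram sums of a reflection-positive Hermitian form.** If `B` is
non-negative and Hermitian on an admissible class of functions closed under `F + t • G`, on which it
expands as `B(F + tG, F + tG) = B(F,F) + conj t · B(G,F) + t · B(F,G) + |t|² B(G,G)`, then for
admissible families `φ, ψ` indexed by a finite type,
`‖Σ_k B(φ_k, ψ_k)‖² ≤ Re Σ_k B(φ_k, φ_k) · Re Σ_k B(ψ_k, ψ_k)` — the `2 × 2` matrix of Gram sums is
positive semidefinite. -/
theorem norm_sum_form_sq_le (B : (X → ℂ) → (X → ℂ) → ℂ) (Adm : (X → ℂ) → Prop)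
    (hpos : ∀ F, Adm F → 0 ≤ B F F)
    (hherm : ∀ F G, Adm F → Adm G → B G F = conj (B F G))
    (hadd : ∀ F G (t : ℂ), Adm F → Adm G →
      B (F + t • G) (F + t • G) = B F F + conj t * B G F + t * B F G + conj t * t * B G G)
    (hadm : ∀ F G (t : ℂ), Adm F → Adm G → Adm (F + t • G))
    (φ ψ : K → X → ℂ) (hφ : ∀ k, Adm (φ k)) (hψ : ∀ k, Adm (ψ k)) :
    ‖∑ k, B (φ k) (ψ k)‖ ^ 2 ≤ (∑ k, B (φ k) (φ k)).re * (∑ k, B (ψ k) (ψ k)).re := by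
  have ha := re_sum_form_nonneg B Adm hpos φ hφ
  have hc := re_sum_form_nonneg B Adm hpos ψ hψ
  refine Literature.MathematicalPhysics.QuantumFieldTheory.WilsonSiteRP.normSq_le_mul_of_forall_quadratic
    ha hc fun t => ?_
  -- the quadratic form at `φ + t ψ`
  have hq : 0 ≤ (∑ k, B (φ k + t • ψ k) (φ k + t • ψ k)).re :=
    re_sum_form_nonneg B Adm hpos (fun k => φ k + t • ψ k) fun k => hadm _ _ t (hφ k) (hψ k)
  have hexp : (∑ k, B (φ k + t • ψ k) (φ k + t • ψ k)).re =
      (∑ k, B (φ k) (φ k)).re + 2 * (t * ∑ k, B (φ k) (ψ k)).re +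
        ‖t‖ ^ 2 * (∑ k, B (ψ k) (ψ k)).re := by
    have hk : ∀ k, B (φ k + t • ψ k) (φ k + t • ψ k) =
        B (φ k) (φ k) + conj t * conj (B (φ k) (ψ k)) + t * B (φ k) (ψ k) +
          conj t * t * B (ψ k) (ψ k) := fun k => by
      rw [hadd _ _ t (hφ k) (hψ k), hherm _ _ (hφ k) (hψ k)]
    simp_rw [hk]
    rw [Finset.sum_add_distrib, Finset.sum_add_distrib, Finset.sum_add_distrib, ← Finset.mul_sum,
      ← Finset.mul_sum, ← Finset.mul_sum, Complex.add_re, Complex.add_re, Complex.add_re]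
    have h1 : (conj t * ∑ k, conj (B (φ k) (ψ k))).re = (t * ∑ k, B (φ k) (ψ k)).re := by
      rw [← map_sum, ← map_mul, Complex.conj_re]
    have h2 : (conj t * t * ∑ k, B (ψ k) (ψ k)).re = ‖t‖ ^ 2 * (∑ k, B (ψ k) (ψ k)).re := by
      rw [mul_comm (conj t) t, Complex.mul_conj, Complex.normSq_eq_norm_sq]
      push_cast
      rw [← Complex.ofReal_pow, Complex.re_ofReal_mul]
    rw [h1, h2]
    ring
  rw [hexp] at hq
  exact hq

end Summit.QuantumFields.QCD.Theorems.UnquenchedChessboardBoundLine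

end
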